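import Summits.CriticalPhenomena.CardyFormulaZ2.Theorems.CardyIKTransportIKLinearTransportLine
import Literature.Probability.Percolation.QuadCrossingSquareModel
import Literature.Probability.RandomPlanarGeometry.MarkedDomainCorners
import Mathlib.Topology.UniformSpace.Compact

/-!
# Stub `stub_CouplingToLimits` (line `pinned-diagram-exchange`, crux `CardyIKTransport.IKLinearTransport`,
# stmt-CriticalPhenomena-5076) — part 1: limit algebra, comparison rectangles and their moduli

Support file (`--supports stmt-CriticalPhenomena-5076`) for the registered stub
`stub_CouplingToLimits : (∃ K₁, IsTransportCoupling K₁) → (∃ K₀, IsTriShear K₀ ∧ CrudeCardyAlong K₀ ∅) →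
∃ K₁, TransportsWithin K₁` of the lead's skeleton (`Cruxes/IKLinearTransport/Lines/pinned-diagram-exchange.lean`).
All helpers live in the sub-namespace `CouplingToLimits`.

* LIMIT ALGEBRA: `tendsto_of_forall_sandwich` (a real function squeezed, for every `θ > 0`, eventually
  between `a - θ` and `b + θ` where `a → A`, `b → B`, `|A - c|, |B - c| < θ`, tends to `c`);
  `transportsWithin_of_forall_hasCrossingLimit` (since the `S = ∅` member has Cardy LIMITS along `K₀` for
  every conformal rectangle, the `∀ L, … ↔ …` shape of `TransportsWithin K₁` follows from Cardy's formula for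
  the isotropic member on `K₀K₁`-images, by uniqueness of limits along the non-trivial filter `𝓝[>] 0`);
  the reduction `stub_CouplingToLimits_of`.
* COMPARISON RECTANGLES: Schramm–Smirnov's perturbations `perturbQuad Ψ x₀ x₁ y₀ y₁` (tree,
  `QuadCrossingSquareModel.lean`) of a conformal rectangle read through a square model `Φ`
  (`exists_isSquareModel`, Schoenflies): their boundary loops are `Ψ`-images of stretched square loops
  (`perturbQuad_boundary_apply`) and converge UNIFORMLY when the model rectangles converge
  (`tendstoUniformly_boundary_perturbQuad`) — the input of the tree's Radó corollary
  `ConformalRectangle.tendsto_crossRatio_of_tendsto_mark` (continuity of the modulus); a square model sends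
  corners to marked points (`isSquareModel_apply_pt`), so the unperturbed quad has the carrier, arcs and
  marked points of `R`.

References: O. Schramm, S. Smirnov, Ann. Probab. 39 (2011) §1.3 and proof of Lemma 5.1; Ch. Pommerenke,
*Boundary Behaviour of Conformal Maps* (1992) Thm. 2.11 (Radó); the line card
`Cruxes/IKLinearTransport/Lines/pinned-diagram-exchange.md`.
-/

noncomputable section

namespace Summit.CriticalPhenomena.CardyFormulaZ2.Theorems.IKLinearTransport.PinnedDiagramExchange

open scoped Topology
open Filter Set Function Metric
open Literature.Probability.Percolation hiding cardyFunction
open Literature.Probability.LatticeModels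
open Literature.Probability.RandomPlanarGeometry

namespace CouplingToLimits

/-! ## Limit algebra -/

/-- SANDWICH WITH MOVING BOUNDS. If for every `θ > 0` there are functions `a, b` with limits `A, B`
along `l`, both within `θ` of `c`, such that eventually `a - θ ≤ f ≤ b + θ`, then `f → c` along `l`. [folklore] -/
theorem tendsto_of_forall_sandwich {α : Type*} {f : α → ℝ} {c : ℝ} {l : Filter α}
    (h : ∀ θ : ℝ, 0 < θ → ∃ (a b : α → ℝ) (A B : ℝ), |A - c| < θ ∧ |B - c| < θ ∧
      Tendsto a l (𝓝 A) ∧ Tendsto b l (𝓝 B) ∧ ∀ᶠ x in l, a x - θ ≤ f x ∧ f x ≤ b x + θ) :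
    Tendsto f l (𝓝 c) := by
  rw [Metric.tendsto_nhds]
  intro e he
  obtain ⟨a, b, A, B, hA, hB, ha, hb, hev⟩ := h (e / 3) (by positivity)
  have ha' := (Metric.tendsto_nhds.1 ha) (e / 3) (by positivity)
  have hb' := (Metric.tendsto_nhds.1 hb) (e / 3) (by positivity)
  filter_upwards [hev, ha', hb'] with x hx hxa hxb
  rw [Real.dist_eq, abs_sub_lt_iff] at hxa hxb ⊢
  rw [abs_sub_lt_iff] at hA hB
  constructor <;> linarith [hx.1, hx.2]

/-- Crossing limits only depend on the carrier and the marked points of a conformal rectangle (the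
uniformizing data are literally the same). [folklore] -/
theorem hasCrossingLimit_of_carrier_eq_of_pt_eq {R S : ConformalRectangle} (hc : S.carrier = R.carrier)
    (hpt : ∀ i, S.pt i = R.pt i) {p F : ℝ → ℝ} (h : R.HasCrossingLimit p F) : S.HasCrossingLimit p F :=
  (ConformalRectangle.hasCrossingLimit_iff_of_image_data (R := R) (S := S) (h := id)
    differentiableOn_id (Set.injOn_id _) continuousOn_id (by simpa using hc) (by simpa using hpt)).2 h

/-- FROM CARDY ON `K₀K₁`-IMAGES TO THE `↔` OF LIMITS. If the `S = ∅` member has Cardy limits along `K₀`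
for every conformal rectangle and the isotropic member (`S = univ`) has, in every `R`, the Cardy limit in
the modulus of `K₀ K₁ R`, then `TransportsWithin K₁`. [folklore] -/
theorem transportsWithin_of_forall_hasCrossingLimit {K₀ K₁ : ℂ ≃L[ℝ] ℂ} (hC : CrudeCardyAlong K₀ ∅)
    (h : ∀ R : ConformalRectangle,
      ConformalRectangle.HasCrossingLimit ((R.map K₁.toHomeomorph).map K₀.toHomeomorph)
        (mixedCrossingProb Set.univ R) cardyFunction) :
    TransportsWithin K₁ := by
  intro R L
  obtain ⟨φ, x, hφx⟩ :=
    MarkedDomain.exists_isUniformizing_holds ((R.map K₁.toHomeomorph).map K₀.toHomeomorph)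
  have h1 : Tendsto (mixedCrossingProb Set.univ R) (𝓝[>] 0) (𝓝 (cardyFunction (crossRatio x))) :=
    h R φ x hφx
  have h2 : Tendsto (mixedCrossingProb ∅ (R.map K₁.toHomeomorph)) (𝓝[>] 0)
      (𝓝 (cardyFunction (crossRatio x))) :=
    hC (R.map K₁.toHomeomorph) φ x hφx
  constructor
  · intro hL
    rw [tendsto_nhds_unique hL h1]
    exact h2
  · intro hL
    rw [tendsto_nhds_unique hL h2]
    exact h1

/-- The stub, REDUCED: it suffices to prove Cardy's formula for the isotropic member on `K₀K₁`-images
from a transport coupling through `K₁` and crude Cardy along `K₀` for the `S = ∅` member. [folklore] -/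
theorem stub_CouplingToLimits_of
    (hmain : ∀ K₁ K₀ : ℂ ≃L[ℝ] ℂ, IsTransportCoupling K₁ → CrudeCardyAlong K₀ ∅ →
      ∀ R : ConformalRectangle,
        ConformalRectangle.HasCrossingLimit ((R.map K₁.toHomeomorph).map K₀.toHomeomorph)
          (mixedCrossingProb Set.univ R) cardyFunction) :
    (∃ K₁ : ℂ ≃L[ℝ] ℂ, IsTransportCoupling K₁) → (∃ K₀ : ℂ ≃L[ℝ] ℂ, IsTriShear K₀ ∧ CrudeCardyAlong K₀ ∅) →
      ∃ K₁ : ℂ ≃L[ℝ] ℂ, TransportsWithin K₁ := by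
  rintro ⟨K₁, hK₁⟩ ⟨K₀, -, hK₀⟩
  exact ⟨K₁, transportsWithin_of_forall_hasCrossingLimit hK₀ (hmain K₁ K₀ hK₁ hK₀)⟩

/-! ## Boundary loops of perturbed quads -/

/-- Linear-like maps commute with piecewise-affine interpolation. [folklore] -/
theorem affineInterp_map {f : ℂ → ℂ} (hf : ∀ (a b : ℂ) (θ : ℝ),
    f (AffineMap.lineMap a b θ) = AffineMap.lineMap (f a) (f b) θ) (h0 : f 0 = 0) :
    ∀ (l : List ℂ) (s : ℝ), affineInterp (l.map f) s = f (affineInterp l s)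
  | [], s => by simp [affineInterp, h0]
  | [a], s => by simp [affineInterp]
  | a :: b :: l, s => by
    simp only [List.map_cons, affineInterp_cons_cons]
    split_ifs with h
    · exact (hf a b s).symm
    · have := affineInterp_map hf h0 (b :: l) (s - 1)
      simpa using this

/-- Linear-like maps commute with closed polygons. [folklore] -/
theorem polygonLoop_map {f : ℂ → ℂ} (hf : ∀ (a b : ℂ) (θ : ℝ),
    f (AffineMap.lineMap a b θ) = AffineMap.lineMap (f a) (f b) θ) (h0 : f 0 = 0) (l : List ℂ) (t : ℝ) :
    polygonLoop (l.map f) t = f (polygonLoop l t) := by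
  unfold polygonLoop
  rw [List.length_map, ← List.map_take, ← List.map_append, affineInterp_map hf h0]

/-- The closed polygon of the rectangle `[-a, a] × [-b, b]` is the coordinate stretch of that of the
square `[-1, 1]²`. [folklore] -/
theorem polygonLoop_rectVerts_eq_stretch (a b t : ℝ) :
    polygonLoop (rectVerts a b) t =
      ⟨a * (polygonLoop (rectVerts 1 1) t).re, b * (polygonLoop (rectVerts 1 1) t).im⟩ := by
  set f : ℂ → ℂ := fun z => ⟨a * z.re, b * z.im⟩ with hf
  have hlin : ∀ (p q : ℂ) (θ : ℝ), f (AffineMap.lineMap p q θ) = AffineMap.lineMap (f p) (f q) θ := by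
    intro p q θ
    apply Complex.ext <;> simp [hf, AffineMap.lineMap_apply_module'] <;> ring
  have h0 : f 0 = 0 := by apply Complex.ext <;> simp [hf]
  have hverts : rectVerts a b = (rectVerts 1 1).map f := by
    simp only [rectVerts, List.map_cons, List.map_nil, hf]
    norm_num
  rw [hverts, polygonLoop_map hlin h0]

/-- The boundary loop of a perturbed quad, read in the chart. [folklore] -/
theorem perturbQuad_boundary_apply (Ψ : ℂ ≃ₜ ℂ) {x₀ x₁ y₀ y₁ : ℝ} (hx : x₀ < x₁) (hy : y₀ < y₁) (t : ℝ) :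
    (perturbQuad Ψ x₀ x₁ y₀ y₁ hx hy).boundary t =
      Ψ (⟨(x₁ - x₀) / 2 * (polygonLoop (rectVerts 1 1) t).re,
          (y₁ - y₀) / 2 * (polygonLoop (rectVerts 1 1) t).im⟩ + ⟨(x₀ + x₁) / 2, (y₀ + y₁) / 2⟩) := by
  rw [← polygonLoop_rectVerts_eq_stretch]
  rfl

/-- The square's boundary loop stays in `[-1, 1]²`. [folklore] -/
theorem abs_polygonLoop_rectVerts_one_le (t : ℝ) :
    |(polygonLoop (rectVerts 1 1) t).re| ≤ 1 ∧ |(polygonLoop (rectVerts 1 1) t).im| ≤ 1 := by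
  have hmem : polygonLoop (rectVerts 1 1) t ∈ frontier (symRect 1 1) := by
    rw [← range_polygonLoop_rectVerts one_pos one_pos]; exact mem_range_self t
  have hcl : polygonLoop (rectVerts 1 1) t ∈ Icc (-1 : ℝ) 1 ×ℂ Icc (-1 : ℝ) 1 := by
    have h := frontier_subset_closure hmem
    rwa [symRect, Complex.closure_reProdIm, closure_Ioo (by norm_num)] at h
  rw [Complex.mem_reProdIm, mem_Icc, mem_Icc] at hcl
  exact ⟨abs_le.2 hcl.1, abs_le.2 hcl.2⟩

/-- UNIFORM CONVERGENCE OF THE BOUNDARY LOOPS of perturbed quads whose model rectangles converge. [folklore] -/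
theorem tendstoUniformly_boundary_perturbQuad (Ψ : ℂ ≃ₜ ℂ) {x₀ x₁ y₀ y₁ : ℕ → ℝ} {X₀ X₁ Y₀ Y₁ : ℝ}
    (hx : ∀ n, x₀ n < x₁ n) (hy : ∀ n, y₀ n < y₁ n) (HX : X₀ < X₁) (HY : Y₀ < Y₁)
    (h₀ : Tendsto x₀ atTop (𝓝 X₀)) (h₁ : Tendsto x₁ atTop (𝓝 X₁)) (h₂ : Tendsto y₀ atTop (𝓝 Y₀))
    (h₃ : Tendsto y₁ atTop (𝓝 Y₁)) :
    TendstoUniformly (fun n => (perturbQuad Ψ (x₀ n) (x₁ n) (y₀ n) (y₁ n) (hx n) (hy n)).boundary)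
      (perturbQuad Ψ X₀ X₁ Y₀ Y₁ HX HY).boundary atTop := by
  set γ : ℝ → ℂ := polygonLoop (rectVerts 1 1) with hγdef
  set g : ℕ → ℝ → ℂ := fun n t =>
    (⟨(x₁ n - x₀ n) / 2 * (γ t).re, (y₁ n - y₀ n) / 2 * (γ t).im⟩ : ℂ) + ⟨(x₀ n + x₁ n) / 2, (y₀ n + y₁ n) / 2⟩
    with hgdef
  set G : ℝ → ℂ := fun t =>
    (⟨(X₁ - X₀) / 2 * (γ t).re, (Y₁ - Y₀) / 2 * (γ t).im⟩ : ℂ) + ⟨(X₀ + X₁) / 2, (Y₀ + Y₁) / 2⟩ with hGdef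
  have hbn : ∀ n t, (perturbQuad Ψ (x₀ n) (x₁ n) (y₀ n) (y₁ n) (hx n) (hy n)).boundary t = Ψ (g n t) :=
    fun n t => perturbQuad_boundary_apply Ψ (hx n) (hy n) t
  have hb : ∀ t, (perturbQuad Ψ X₀ X₁ Y₀ Y₁ HX HY).boundary t = Ψ (G t) :=
    fun t => perturbQuad_boundary_apply Ψ HX HY t
  -- coordinatewise bound for the difference of the model loops
  have hdiff : ∀ n t, dist (G t) (g n t) ≤ |(X₁ - X₀) / 2 - (x₁ n - x₀ n) / 2| +
      |(X₀ + X₁) / 2 - (x₀ n + x₁ n) / 2| + (|(Y₁ - Y₀) / 2 - (y₁ n - y₀ n) / 2| +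
      |(Y₀ + Y₁) / 2 - (y₀ n + y₁ n) / 2|) := by
    intro n t
    obtain ⟨hre, him⟩ := abs_polygonLoop_rectVerts_one_le t
    rw [dist_eq_norm]
    refine (Complex.norm_le_abs_re_add_abs_im _).trans (add_le_add ?_ ?_)
    · simp only [hGdef, hgdef, Complex.sub_re, Complex.add_re]
      have : (X₁ - X₀) / 2 * (γ t).re + (X₀ + X₁) / 2 - ((x₁ n - x₀ n) / 2 * (γ t).re + (x₀ n + x₁ n) / 2) =
          ((X₁ - X₀) / 2 - (x₁ n - x₀ n) / 2) * (γ t).re + ((X₀ + X₁) / 2 - (x₀ n + x₁ n) / 2) := by ring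
      rw [this]
      refine (abs_add_le _ _).trans (add_le_add ?_ le_rfl)
      rw [abs_mul]
      exact mul_le_of_le_one_right (abs_nonneg _) hre
    · simp only [hGdef, hgdef, Complex.sub_im, Complex.add_im]
      have : (Y₁ - Y₀) / 2 * (γ t).im + (Y₀ + Y₁) / 2 - ((y₁ n - y₀ n) / 2 * (γ t).im + (y₀ n + y₁ n) / 2) =
          ((Y₁ - Y₀) / 2 - (y₁ n - y₀ n) / 2) * (γ t).im + ((Y₀ + Y₁) / 2 - (y₀ n + y₁ n) / 2) := by ring
      rw [this]
      refine (abs_add_le _ _).trans (add_le_add ?_ le_rfl)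
      rw [abs_mul]
      exact mul_le_of_le_one_right (abs_nonneg _) him
  -- the model loops converge uniformly
  have hgG : TendstoUniformly g G atTop := by
    rw [Metric.tendstoUniformly_iff]
    intro ε hε
    have hA : Tendsto (fun n => (x₁ n - x₀ n) / 2) atTop (𝓝 ((X₁ - X₀) / 2)) := (h₁.sub h₀).div_const 2
    have hB : Tendsto (fun n => (x₀ n + x₁ n) / 2) atTop (𝓝 ((X₀ + X₁) / 2)) := (h₀.add h₁).div_const 2
    have hC : Tendsto (fun n => (y₁ n - y₀ n) / 2) atTop (𝓝 ((Y₁ - Y₀) / 2)) := (h₃.sub h₂).div_const 2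
    have hD : Tendsto (fun n => (y₀ n + y₁ n) / 2) atTop (𝓝 ((Y₀ + Y₁) / 2)) := (h₂.add h₃).div_const 2
    have hε4 : 0 < ε / 4 := by positivity
    filter_upwards [(Metric.tendsto_nhds.1 hA) _ hε4, (Metric.tendsto_nhds.1 hB) _ hε4,
      (Metric.tendsto_nhds.1 hC) _ hε4, (Metric.tendsto_nhds.1 hD) _ hε4] with n hnA hnB hnC hnD t
    rw [Real.dist_eq, abs_sub_comm] at hnA hnB hnC hnD
    linarith [hdiff n t]
  -- a compact containing all loops eventually, uniform continuity of `Ψ` there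
  set M : ℝ := |(X₁ - X₀) / 2| + |(X₀ + X₁) / 2| + (|(Y₁ - Y₀) / 2| + |(Y₀ + Y₁) / 2|) with hMdef
  have hGM : ∀ t, ‖G t‖ ≤ M := by
    intro t
    obtain ⟨hre, him⟩ := abs_polygonLoop_rectVerts_one_le t
    refine (Complex.norm_le_abs_re_add_abs_im _).trans (add_le_add ?_ ?_)
    · simp only [hGdef, Complex.add_re]
      refine (abs_add_le _ _).trans (add_le_add ?_ le_rfl)
      rw [abs_mul]; exact mul_le_of_le_one_right (abs_nonneg _) hre
    · simp only [hGdef, Complex.add_im]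
      refine (abs_add_le _ _).trans (add_le_add ?_ le_rfl)
      rw [abs_mul]; exact mul_le_of_le_one_right (abs_nonneg _) him
  have hKc : IsCompact (closedBall (0 : ℂ) (M + 1)) := isCompact_closedBall _ _
  have huc : UniformContinuousOn Ψ (closedBall (0 : ℂ) (M + 1)) :=
    hKc.uniformContinuousOn_of_continuous Ψ.continuous.continuousOn
  rw [Metric.tendstoUniformly_iff]
  intro ε hε
  obtain ⟨d, hd, hud⟩ := Metric.uniformContinuousOn_iff.1 huc ε hε
  filter_upwards [(Metric.tendstoUniformly_iff.1 hgG) (min d 1) (lt_min hd one_pos)] with n hn t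
  rw [hb, hbn]
  have h1 : dist (G t) (g n t) < min d 1 := hn t
  refine hud (G t) ?_ (g n t) ?_ (h1.trans_le (min_le_left _ _))
  · exact mem_closedBall_zero_iff.2 ((hGM t).trans (by linarith))
  · rw [mem_closedBall_zero_iff]
    have := norm_le_norm_add_norm_sub' (g n t) (G t)
    have h2 : ‖G t - g n t‖ < 1 := by rw [← dist_eq_norm]; exact h1.trans_le (min_le_right _ _)
    rw [norm_sub_rev] at h2
    linarith [hGM t]

/-- Perturbed quads carry the quarter marks. [folklore] -/
theorem perturbQuad_mark (Ψ : ℂ ≃ₜ ℂ) {x₀ x₁ y₀ y₁ : ℝ} (hx : x₀ < x₁) (hy : y₀ < y₁) :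
    (perturbQuad Ψ x₀ x₁ y₀ y₁ hx hy).mark = quarterMarks := rfl

/-! ## The square model: corners, carrier, arcs -/

section SquareModel

variable {R : ConformalRectangle} {Φ : ℂ ≃ₜ ℂ}

/-- A square model maps the corners of the square to the marked points. [folklore] -/
theorem isSquareModel_apply_pt (h : IsSquareModel R Φ) (i : Fin 4) : Φ (unitSquareQuad.pt i) = R.pt i := by
  have hA : ∀ j : Fin 4, j + 3 ≠ j := by decide
  have hB : ∀ j : Fin 4, j + 3 + 1 = j := by decide
  have hC : ∀ j : Fin 4, j + 1 ≠ j + 3 := by decide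
  have hD : ∀ j : Fin 4, j + 1 ≠ j := by decide
  have h1 : Φ (unitSquareQuad.pt i) ∈ R.arc i := by
    rw [← h.image_arc i]; exact mem_image_of_mem _ (unitSquareQuad.pt_mem_arc_self i)
  have h2 : Φ (unitSquareQuad.pt i) ∈ R.arc (i + 3) := by
    rw [← h.image_arc (i + 3)]
    refine mem_image_of_mem _ ?_
    have := unitSquareQuad.pt_succ_mem_arc (i + 3)
    rwa [hB] at this
  rcases R.mem_arc_inter_arc (hA i) h1 h2 with h3 | h3
  · exact h3
  · exfalso
    rcases R.mem_arc_inter_arc (i := i + 3) (k := i) (fun h => hA i h.symm) h2 h1 with h4 | h4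
    · exact hC i (R.pt_injective (h3.symm.trans h4))
    · rw [hB] at h4
      exact hD i (R.pt_injective (h3.symm.trans h4))

/-- The unperturbed quad of a square model has the carrier of `R`. [folklore] -/
theorem isSquareModel_perturbQuad_carrier (h : IsSquareModel R Φ) (hx hy : (-1 : ℝ) < 1) :
    (perturbQuad Φ (-1) 1 (-1) 1 hx hy).carrier = R.carrier := by
  rw [perturbQuad, MarkedDomain.carrier_map]
  exact h.image_carrier

/-- The unperturbed quad of a square model has the arcs of `R`. [folklore] -/
theorem isSquareModel_perturbQuad_arc (h : IsSquareModel R Φ) (hx hy : (-1 : ℝ) < 1) (k : Fin 4) :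
    (perturbQuad Φ (-1) 1 (-1) 1 hx hy).arc k = R.arc k := by
  rw [perturbQuad, MarkedDomain.arc_map]
  exact h.image_arc k

/-- The unperturbed quad of a square model has the marked points of `R`. [folklore] -/
theorem isSquareModel_perturbQuad_pt (h : IsSquareModel R Φ) (hx hy : (-1 : ℝ) < 1) (i : Fin 4) :
    (perturbQuad Φ (-1) 1 (-1) 1 hx hy).pt i = R.pt i := by
  rw [perturbQuad, MarkedDomain.pt_map]
  exact isSquareModel_apply_pt h i

end SquareModel

/-! ## Charts -/

/-- `(Φ ∘ K) ∘ K⁻¹ = Φ` for plane homeomorphisms. [folklore] -/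
theorem trans_trans_symm_toHomeomorph (Φ : ℂ ≃ₜ ℂ) (K : ℂ ≃L[ℝ] ℂ) :
    (Φ.trans K.toHomeomorph).trans K.symm.toHomeomorph = Φ := by
  ext z
  simp

end CouplingToLimits

/-- REGISTERED SUB-GOAL `stub_CouplingToLimits_reduction` of stub `stub_CouplingToLimits`: it suffices to prove
Cardy's formula for the isotropic member on `K₀K₁`-images (`CouplingToLimits.stub_CouplingToLimits_of`). [folklore] -/
theorem stub_CouplingToLimits_reduction :
    (∀ K₁ K₀ : ℂ ≃L[ℝ] ℂ, IsTransportCoupling K₁ → CrudeCardyAlong K₀ ∅ →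
      ∀ R : ConformalRectangle,
        ConformalRectangle.HasCrossingLimit ((R.map K₁.toHomeomorph).map K₀.toHomeomorph)
          (mixedCrossingProb Set.univ R) Literature.Probability.RandomPlanarGeometry.cardyFunction) →
    (∃ K₁ : ℂ ≃L[ℝ] ℂ, IsTransportCoupling K₁) → (∃ K₀ : ℂ ≃L[ℝ] ℂ, IsTriShear K₀ ∧ CrudeCardyAlong K₀ ∅) →
      ∃ K₁ : ℂ ≃L[ℝ] ℂ, TransportsWithin K₁ :=
  CouplingToLimits.stub_CouplingToLimits_of

end Summit.CriticalPhenomena.CardyFormulaZ2.Theorems.IKLinearTransport.PinnedDiagramExchange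

end
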